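/-
Copyright (c) 2026 the pub-hodgecm-mathlib formalisation cell (harness21).  Prover seat hodgecm-mathlib-LH4-p08 (g8), req620 Track A «(D-RAM) FOUR-FRAME» squad, helper lane
on h413 = stmt-HodgeConjecture-24833 (count-neutral).  STAGE-1b, row (2) cone road (dealer∕pen LH4-plan (g13) WORD #71 (3) «(W-U-scaled) THE TYPE-U CUT WELD AT THE SCALED
MULTIPLIER», for LH4-p07 (g9)'s (LAW) files; T5a lineage LH4-p08 (g4–g5)).  2026-09-04.
-/
import Summits.HodgeConjecture.HodgeConjecture.Theorems.F0P3cDyRamToricLevelCensusUnrTopScaled          -- ★ p859927 (this seat): (D3♯)-Unr `ncard_levelSetDep_top_hyper∕aniso_inv_mul`; brings ★ T5a (R1), UnrTop∕TopAniso∕TopSide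
import Summits.HodgeConjecture.HodgeConjecture.Theorems.F0P3cDyRamToricCensusSumUnrV5CutoffOffset       -- ★ p859988 (this seat): `toricCensusSum_unr_v5_cutoff_offset` (even class)
import Summits.HodgeConjecture.HodgeConjecture.Theorems.F0P3cDyRamToricCensusSumUnrV5FlipCutoff         -- ★ p859898 (this seat): `toricCensusSum_unr_v5_flip_cutoff_offset` (odd class)
import HarnessLib

/-!
# T5a × T5s, type U: THE CUT WELD AT THE SCALED MULTIPLIER `μ₁ = t⁻¹(λ − u)` —
# `ε·Σ_{j ≤ jλ₁} Σ_a q^a·[j + a ≤ C]·(#levelSetDep_h(j,a;μ₁) − #levelSetDep_{h′}(j,a;μ₁))` in closed form, both parity classes of `e = v(t)`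

Cell `hodgecm-mathlib` (D-0151), FLOOR 0, crux item H413 = `stmt-HodgeConjecture-24833`, route of record `HCCMUnconditional`; squad F0∕P3c∕LH4 (req618∕req620); helper lane
`--supports stmt-HodgeConjecture-24833 --as helper` (count-neutral).  THEOREMS ONLY (no `def`, no instance, no notation, no `sorry`; default heartbeats).

WHAT.  ★ `toricCensusSum_unr_weld` (this lineage, g5) welds ★ T5s-v5 to the ★ T5a lattice counts at the UNIT multiplier `μ = λ − u`.  The level template pieces of LH4-p07 (g9)'s
(LAW) road (★ p859713, LAW-INSTANCES v1) need the same weld at the SCALED multiplier `μ₁ = t⁻¹(λ − u)` (`ρ t = t`, `|t| = exp(−e)`, tokens `m₁ + e = m`, `jλ₁ + e = jλ`) with the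
cone cut along `j + a ≤ C` (`jλ₁ ≤ C`, `C + d ≤ m₁ + jλ₁ + 1`).  THIS FILE types it:
* §1 `exists_tables_inv_mul` — the eight ★ T5s-v5 table letters AT `μ₁` (off-diagonal ∕ low cells by ★ T5a (R1) `ncard_levelSetDep_zero ∕ _offDiag ∕ _diag_low`, any multiplier;
  top cells by ★ p859927 `ncard_levelSetDep_top_hyper∕aniso_inv_mul` — the `hvTopPE ∕ hvTopME` sentences with the alive conjunct `2j + d ≤ 2jλ₁ + 1 + e`), packaged once as
  `∃ nP nM vP vM, …` with `vP∕vM j a = #levelSetDep(j,a;μ₁)` on `j ≤ jλ₁`;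
* §2 **`toricCensusSum_unr_weld_inv_mul`** (EVEN class: `jλ₁` even, ε = 1 branch `m₁ ≡ d (2)`) — §1 ∘ ★ p859988 `toricCensusSum_unr_v5_cutoff_offset`: the cut census difference in
  `#levelSetDep` currency `= q^{m₁}·(1 + (q+1)[jλ₁∕2]_q − 2[S]_q) − the two cut top bands` (★ p859859's RHS at `(m₁, jλ₁)` VERBATIM);
* §2 **`toricCensusSum_unr_weld_inv_mul_flip`** (ODD class: `jλ₁` odd, ε = 1 branch `m₁ ≢ d`) — §1 ∘ ★ p859898 `toricCensusSum_unr_v5_flip_cutoff_offset`: value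
  `q^{m₁}·(1 + (q+1)[⌊jλ₁∕2⌋ + d%2]_q − 2[d − 1 + d%2]_q) − the same bands`.
The consumer supplies the frame of ★ `toricCensusSum_unr_weld` (third field `K′`, the two scalars `h` hyperbolic ∕ `h′` anisotropic, `|2| = |ϖE|^t`), the unit data `(λ, u, m, jλ)`, the
scaling `(t, e, m₁, jλ₁)` and the token-side facts of the class AT `μ₁` (`jλ₁` parity, `S − 1 ≤ m₁`, realizability, `jλ₁ ≤ C`, `C + d ≤ m₁ + jλ₁ + 1`) — the near-1 letters of the LAW.
HONEST LABEL.  Count-neutral (`--supports`): the census difference of abstractly-specified lattices in closed form; no census LAW of a piece is stated (the identification `e = a′`,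
`C = m + jλ − b′` with ★ p859713's objects is the (LAW) file's); pays no registered stub and touches no `Lines/` module; `HC_CM` is proved only modulo the 7 printed citations (2
remaining named inputs: hLiu418 = `stmt-HodgeConjecture-24832`, h413 = `stmt-HodgeConjecture-24833`) until rung 0 closes.

## References
* [Kottwitz1986BaseChangeUnits] R. E. Kottwitz, *Base change for unit elements of Hecke algebras*, Compositio Math. 60 (1986), §1 pp. 240–241.
* [Rogawski1990] J. D. Rogawski, *Automorphic Representations of Unitary Groups in Three Variables*, Ann. of Math. Stud. 123 (1990), §4.9 Prop. 4.9.1 (b) p. 55, Lemma 4.9.3 p. 56.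
* [Jacobowitz1962] R. Jacobowitz, *Hermitian forms over local fields*, Amer. J. Math. 84 (1962), §4.
* [Flicker1998UnitaryFL] Y. Z. Flicker, *Elementary proof of the fundamental lemma for a unitary group*, Canad. J. Math. 50 (1998), Prop. 7 p. 84 (the level tables).
-/

set_option autoImplicit false

open WithZero IsLocalRing Finset
open scoped Valued

namespace Summit.HodgeConjecture.HodgeConjecture.Cruxes.H413.F0P3cDyRamToricCensusSumUnrWeldScaled

open Summit.HodgeConjecture.HodgeConjecture.Cruxes.H413.F0P3cDyRamToricCensusDefs
open Summit.HodgeConjecture.HodgeConjecture.Cruxes.H413.F0P3cDyRamToricLevelCensusUnr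
open Summit.HodgeConjecture.HodgeConjecture.Cruxes.H413.F0P3cDyRamToricLevelCensusUnrTopScaled
open Summit.HodgeConjecture.HodgeConjecture.Cruxes.H413.F0P3cDyRamToricCensusSumUnrV5CutoffOffset (toricCensusSum_unr_v5_cutoff_offset)
open Summit.HodgeConjecture.HodgeConjecture.Cruxes.H413.F0P3cDyRamToricCensusSumUnrV5FlipCutoff (toricCensusSum_unr_v5_flip_cutoff_offset)
open Literature.NumberTheory.LocalFields.QuadraticOrder Literature.NumberTheory.LocalFields.WildQuadraticDatum

variable {K : Type*} [Field K] [Valued K ℤᵐ⁰] {ρ Θ : K →+* K} {α ϖE : K} {d t q : ℕ}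
variable {K' : Type*} [Field K'] [Valued K' ℤᵐ⁰] {σ' : K' →+* K'} {π' : K'}

/-! ## §1 The eight table letters at the scaled multiplier -/

/-- **THE ★ T5s-v5 TABLE LETTERS AT `μ₁ = t⁻¹(λ − u)`.**  In ★ `toricCensusSum_unr_weld`'s frame, with `nP∕nM := #levelSet_h ∕ #levelSet_{h′}` (★ `ncard_levelSet_unr_hyper∕aniso`)
and `vP∕vM j a := #levelSetDep(j,a;μ₁)` on `j ≤ jλ₁` (extended above `jλ₁` by the letter values), the eight hypotheses of ★ `toricCensusSum_unr_v5` hold at the tokens `(m₁, jλ₁)` —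
the two top-row letters with the alive conjunct `2j + d ≤ 2jλ₁ + 1 + e` (★ p859927). [cite: Kottwitz1986BaseChangeUnits, §1 pp. 240–241] [cite: Jacobowitz1962, §4]
[cite: Flicker1998UnitaryFL, Prop. 7 p. 84] -/
theorem exists_tables_inv_mul [IsDiscreteValuationRing 𝒪[K]] [Finite 𝓀[K]] [IsDiscreteValuationRing 𝒪[K']] [Finite 𝓀[K']] [IsAdicComplete 𝓂[K'] 𝒪[K']]
    (hρρ : ∀ x, ρ (ρ x) = x) (hvρ : ∀ x, Valued.v (ρ x) = Valued.v x) (hΘΘ : ∀ x, Θ (Θ x) = x) (hΘρ : ∀ x, Θ (ρ x) = ρ (Θ x))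
    (hvΘ : ∀ x, Valued.v (Θ x) = Valued.v x) (hα1 : Valued.v α ≤ 1) (hα : Valued.v (α - ρ α) = 1)
    (hρϖE : ρ ϖE = ϖE) (hϖE : Valued.v ϖE = exp (-1 : ℤ)) (hq : Nat.card 𝓀[K] = q ^ 2) (h2 : Valued.v (2 : K) = Valued.v ϖE ^ t)
    (hσ' : ∀ x, σ' (σ' x) = x) (hvσ' : ∀ x, Valued.v (σ' x) = Valued.v x) (hfix' : ∀ x : K', σ' x = x → x ≠ 0 → ∃ n : ℤ, Valued.v x = exp (2 * n))
    (hπ' : Valued.v π' = exp (-1 : ℤ)) (hdd' : Valued.v (π' - σ' π') = Valued.v π' ^ d) (hd : 1 ≤ d) (hq' : Nat.card 𝓀[K'] = q)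
    (jK : K' →+* K) (hjv : ∀ x, Valued.v (jK x) = Valued.v x) (hjΘ : ∀ x, Θ (jK x) = jK x)
    (hjfix : ∀ z : K, Θ z = z → ∃ x, jK x = z) (hjσ : ∀ x, jK (σ' x) = ρ (jK x))
    (hnorm : ∀ z : Kˣ, Θ (z : K) = z → Valued.v (z : K) = 1 → ∃ ω : Kˣ, Valued.v (ω : K) = 1 ∧ (ω : K) * Θ ω = z)
    {h h' : K} (hΘh : Θ h = h) (hh : h ≠ 0) (hhyper : ∃ x : K, x ≠ 0 ∧ h * Θ x * x + ρ (h * Θ x * x) = 0)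
    (hΘh' : Θ h' = h') (hh' : h' ≠ 0) (haniso : ¬ ∃ x : K, x ≠ 0 ∧ h' * Θ x * x + ρ (h' * Θ x * x) = 0)
    {lam u : K} (hlam : lam * Θ lam = 1) (hu : ρ u = u) (hu1 : u * Θ u = 1)
    {m jl : ℕ} (hm : Valued.v (lam - u) = exp (-(m : ℤ))) (hjl : Valued.v ((lam - u) - ρ (lam - u)) = exp (-(jl : ℤ)))
    {tc : K} (hρt : ρ tc = tc) {e : ℕ} (hte : Valued.v tc = exp (-(e : ℤ))) {m₁ jl₁ : ℕ} (hme : m₁ + e = m) (hjle : jl₁ + e = jl)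
    (hq2 : 2 ≤ q) :
    ∃ nP nM vP vM : ℕ → ℕ → ℚ,
      (∀ j a, 1 ≤ a → nP j a = if a + d ≤ j ∧ (j - a - d) % 2 = 0 then ((q : ℚ) ^ 2 - 1) * (q : ℚ) ^ (j - 2 - (j - a - d) / 2) else 0) ∧
      (∀ j, nP j 0 = if (j + d) % 2 = 0 then (if d ≤ j then ((q : ℚ) + 1) * (q : ℚ) ^ ((j + d) / 2 - 1) else (if j = 0 then 1 else ((q : ℚ) + 1) * (q : ℚ) ^ (j - 1))) else 0) ∧
      (∀ j a, nM j a = if (d ≤ j + 1 ∧ a + d = j + 1) ∨ (j + 1 < d ∧ a = 0 ∧ (j + d) % 2 = 1) then (if j = 0 then 1 else ((q : ℚ) + 1) * (q : ℚ) ^ (j - 1)) else 0) ∧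
      (∀ j, vP j 0 = nP j 0 ∧ vM j 0 = nM j 0) ∧
      (∀ j a, 1 ≤ a → j + m₁ ≠ jl₁ + a →
        (vP j a = if 2 * a ≤ m₁ ∧ (j + a ≤ m₁ ∨ j + a ≤ jl₁) then nP j a else 0) ∧ (vM j a = if 2 * a ≤ m₁ ∧ (j + a ≤ m₁ ∨ j + a ≤ jl₁) then nM j a else 0)) ∧
      (∀ j a, 1 ≤ a → j + m₁ = jl₁ + a → 2 * a ≤ m₁ → vP j a = nP j a ∧ vM j a = nM j a) ∧
      (∀ j a, 1 ≤ a → j + m₁ = jl₁ + a → m₁ < 2 * a →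
        vP j a = if (d + m₁ ≤ jl₁ ∧ (jl₁ - d - m₁) % 2 = 0) ∧ 2 * j + d ≤ 2 * jl₁ + 1 + e then nP j a / (((q : ℚ) - 1) * (q : ℚ) ^ ((2 * a - m₁ + 1) / 2 - 1)) else 0) ∧
      (∀ j a, 1 ≤ a → j + m₁ = jl₁ + a → m₁ < 2 * a →
        vM j a = if jl₁ + 1 = d + m₁ ∧ 2 * j + d ≤ 2 * jl₁ + 1 + e then nM j a / (q : ℚ) ^ ((2 * a - m₁) / 2) else 0) ∧
      (∀ j a, j ≤ jl₁ → vP j a = ((levelSetDep ρ Θ α ϖE h j a (tc⁻¹ * (lam - u))).ncard : ℚ) ∧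
        vM j a = ((levelSetDep ρ Θ α ϖE h' j a (tc⁻¹ * (lam - u))).ncard : ℚ)) := by
  classical
  have htc0 : tc ≠ 0 := fun h0 => by rw [h0, map_zero] at hte; exact (exp_ne_zero hte.symm).elim
  -- the tokens of `μ₁`
  have hm₁ : Valued.v (tc⁻¹ * (lam - u)) = exp (-(m₁ : ℤ)) := by
    rw [map_mul, map_inv₀, hte, hm, ← exp_neg, ← exp_add]; congr 1; omega
  have hjl₁ : Valued.v (tc⁻¹ * (lam - u) - ρ (tc⁻¹ * (lam - u))) = exp (-(jl₁ : ℤ)) := by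
    rw [map_mul ρ, map_inv₀, hρt, ← mul_sub, map_mul, map_inv₀, hte, hjl, ← exp_neg, ← exp_add]; congr 1; omega
  have hmjl : m₁ ≤ jl₁ := by
    have hle : Valued.v (tc⁻¹ * (lam - u) - ρ (tc⁻¹ * (lam - u))) ≤ Valued.v (tc⁻¹ * (lam - u)) :=
      (Valuation.map_sub _ _ _).trans (max_le le_rfl (by rw [hvρ]))
    rw [hjl₁, hm₁, exp_le_exp] at hle; omega
  have hq1 : 1 ≤ q := by omega
  have hqQ0 : (q : ℚ) ≠ 0 := Nat.cast_ne_zero.2 (by omega)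
  have hqQ1 : (q : ℚ) - 1 ≠ 0 := sub_ne_zero.2 (by exact_mod_cast (show q ≠ 1 by omega))
  have hcast1 : (((q - 1 : ℕ) : ℚ)) = (q : ℚ) - 1 := by rw [Nat.cast_sub hq1, Nat.cast_one]
  have hcast2 : (((q ^ 2 - 1 : ℕ) : ℚ)) = (q : ℚ) ^ 2 - 1 := by rw [Nat.cast_sub (Nat.one_le_pow _ _ (by omega)), Nat.cast_pow, Nat.cast_one]
  -- the ★ heads, abbreviated
  have HP : ∀ j a, (levelSet ρ Θ α ϖE h j a).ncard =
      if 1 ≤ a ∧ a + d ≤ j ∧ (j - a - d) % 2 = 0 then (q ^ 2 - 1) * q ^ (j - 2 - (j - a - d) / 2)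
      else if a = 0 ∧ (j + d) % 2 = 0 then (if d ≤ j then (q + 1) * q ^ ((j + d) / 2 - 1) else (if j = 0 then 1 else (q + 1) * q ^ (j - 1)))
      else 0 := fun j a =>
    ncard_levelSet_unr_hyper hρρ hvρ hΘΘ hΘρ hvΘ hα1 hα hρϖE hϖE hΘh hh hq hσ' hvσ' hfix' hπ' hdd' hd hq' jK hjv hjΘ hjfix hjσ hnorm hhyper j a
  have HM : ∀ j a, (levelSet ρ Θ α ϖE h' j a).ncard =
      if (d ≤ j + 1 ∧ a + d = j + 1) ∨ (j + 1 < d ∧ a = 0 ∧ (j + d) % 2 = 1) then (if j = 0 then 1 else (q + 1) * q ^ (j - 1)) else 0 := fun j a =>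
    ncard_levelSet_unr_aniso hρρ hvρ hΘΘ hΘρ hvΘ hα1 hα hρϖE hϖE hΘh' hh' hq hσ' hvσ' hfix' hπ' hdd' hd jK hjv hjΘ hjfix hjσ hnorm haniso j a
  -- the tables (above `jλ₁` the depth tables carry the letter values, so that the letters hold for every `j`)
  obtain ⟨nP, hnPdef⟩ : ∃ f : ℕ → ℕ → ℚ, f = fun j a => ((levelSet ρ Θ α ϖE h j a).ncard : ℚ) := ⟨_, rfl⟩
  obtain ⟨nM, hnMdef⟩ : ∃ f : ℕ → ℕ → ℚ, f = fun j a => ((levelSet ρ Θ α ϖE h' j a).ncard : ℚ) := ⟨_, rfl⟩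
  obtain ⟨vP, hvPdef⟩ : ∃ f : ℕ → ℕ → ℚ, f = fun j a =>
      if j ≤ jl₁ then ((levelSetDep ρ Θ α ϖE h j a (tc⁻¹ * (lam - u))).ncard : ℚ) else
        (if a = 0 then nP j 0 else if j + m₁ = jl₁ + a then
          (if (d + m₁ ≤ jl₁ ∧ (jl₁ - d - m₁) % 2 = 0) ∧ 2 * j + d ≤ 2 * jl₁ + 1 + e then nP j a / (((q : ℚ) - 1) * (q : ℚ) ^ ((2 * a - m₁ + 1) / 2 - 1)) else 0)
        else 0) := ⟨_, rfl⟩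
  obtain ⟨vM, hvMdef⟩ : ∃ f : ℕ → ℕ → ℚ, f = fun j a =>
      if j ≤ jl₁ then ((levelSetDep ρ Θ α ϖE h' j a (tc⁻¹ * (lam - u))).ncard : ℚ) else
        (if a = 0 then nM j 0 else if j + m₁ = jl₁ + a then
          (if jl₁ + 1 = d + m₁ ∧ 2 * j + d ≤ 2 * jl₁ + 1 + e then nM j a / (q : ℚ) ^ ((2 * a - m₁) / 2) else 0)
        else 0) := ⟨_, rfl⟩
  refine ⟨nP, nM, vP, vM, ?_, ?_, ?_, ?_, ?_, ?_, ?_, ?_, ?_⟩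
  · -- (1) `hnP`
    intro j a ha
    rw [hnPdef]; dsimp only; rw [HP j a]
    by_cases hc : a + d ≤ j ∧ (j - a - d) % 2 = 0
    · rw [if_pos ⟨ha, hc⟩, if_pos hc, Nat.cast_mul, hcast2, Nat.cast_pow]
    · rw [if_neg (fun h3 => hc h3.2), if_neg (by omega), if_neg hc, Nat.cast_zero]
  · -- (2) `hnP0`
    intro j
    rw [hnPdef]; dsimp only; rw [HP j 0, if_neg (by omega)]
    by_cases hpar : (j + d) % 2 = 0
    · rw [if_pos ⟨rfl, hpar⟩, if_pos hpar]; push_cast; rfl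
    · rw [if_neg (fun h3 => hpar h3.2), if_neg hpar, Nat.cast_zero]
  · -- (3) `hnM`
    intro j a
    rw [hnMdef]; dsimp only; rw [HM j a]; push_cast; rfl
  · -- (4) `hv0`
    intro j
    by_cases hj : j ≤ jl₁
    · rw [hvPdef, hvMdef, hnPdef, hnMdef]; dsimp only; rw [if_pos hj, if_pos hj,
        ncard_levelSetDep_zero hρρ hvρ hΘΘ hΘρ hvΘ hα1 hα hρϖE hϖE hh hm₁ hjl₁ hj,
        ncard_levelSetDep_zero hρρ hvρ hΘΘ hΘρ hvΘ hα1 hα hρϖE hϖE hh' hm₁ hjl₁ hj]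
      exact ⟨rfl, rfl⟩
    · rw [hvPdef, hvMdef]; dsimp only; rw [if_neg hj, if_neg hj, if_pos rfl, if_pos rfl]
      exact ⟨rfl, rfl⟩
  · -- (5) `hvOff`
    intro j a ha hoff
    by_cases hj : j ≤ jl₁
    · rw [hvPdef, hvMdef, hnPdef, hnMdef]; dsimp only; rw [if_pos hj, if_pos hj,
        ncard_levelSetDep_offDiag hρρ hvρ hΘΘ hΘρ hvΘ hα1 hα hρϖE hϖE hh hm₁ hjl₁ ha hoff,
        ncard_levelSetDep_offDiag hρρ hvρ hΘΘ hΘρ hvΘ hα1 hα hρϖE hϖE hh' hm₁ hjl₁ ha hoff]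
      constructor <;> (split_ifs <;> simp)
    · rw [hvPdef, hvMdef]; dsimp only
      have h1 : ¬ (2 * a ≤ m₁ ∧ (j + a ≤ m₁ ∨ j + a ≤ jl₁)) := by omega
      have h2 : ¬ a = 0 := by omega
      rw [if_neg hj, if_neg hj, if_neg h2, if_neg h2, if_neg hoff, if_neg hoff, if_neg h1, if_neg h1]
      exact ⟨rfl, rfl⟩
  · -- (6) `hvLow`
    intro j a ha hdiag hlow
    have hj : j ≤ jl₁ := by omega
    rw [hvPdef, hvMdef, hnPdef, hnMdef]; dsimp only; rw [if_pos hj, if_pos hj,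
      ncard_levelSetDep_diag_low hρρ hvρ hΘΘ hΘρ hvΘ hα1 hα hρϖE hϖE hh hm₁ hjl₁ ha hdiag hlow,
      ncard_levelSetDep_diag_low hρρ hvρ hΘΘ hΘρ hvΘ hα1 hα hρϖE hϖE hh' hm₁ hjl₁ ha hdiag hlow]
    exact ⟨rfl, rfl⟩
  · -- (7) `hvTopPE`: ★ p859927, hyperbolic
    intro j a ha hdiag htop
    by_cases hj : j ≤ jl₁
    · have H := ncard_levelSetDep_top_hyper_inv_mul hρρ hvρ hΘΘ hΘρ hvΘ hα1 hα hρϖE hϖE h2 hΘh hh hq hσ' hvσ' hfix' hπ' hdd' hd hq' jK hjv hjΘ hjfix hjσ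
        hnorm hhyper hlam hu hu1 hm hjl hρt hte hme hjle hj ha hdiag (by omega)
      have hφ : ((q : ℚ) - 1) * (q : ℚ) ^ ((2 * a - m₁ + 1) / 2 - 1) ≠ 0 := mul_ne_zero hqQ1 (pow_ne_zero _ hqQ0)
      rw [hvPdef, hnPdef]; dsimp only; rw [if_pos hj]
      by_cases hc : (d + m₁ ≤ jl₁ ∧ (jl₁ - d - m₁) % 2 = 0) ∧ 2 * j + d ≤ 2 * jl₁ + 1 + e
      · rw [if_pos hc] at H
        rw [if_pos hc, eq_div_iff hφ]
        have := congrArg (Nat.cast : ℕ → ℚ) H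
        rw [Nat.cast_mul, Nat.cast_mul, hcast1, Nat.cast_pow] at this
        linear_combination this
      · rw [if_neg hc] at H
        rw [if_neg hc]
        have hφN : (q - 1) * q ^ ((2 * a - m₁ + 1) / 2 - 1) ≠ 0 := mul_ne_zero (by omega) (pow_ne_zero _ (by omega))
        rw [(mul_eq_zero.1 H).resolve_left hφN, Nat.cast_zero]
    · rw [hvPdef]; dsimp only; rw [if_neg hj, if_neg (by omega), if_pos hdiag]
  · -- (8) `hvTopME`: ★ p859927, anisotropic
    intro j a ha hdiag htop
    by_cases hj : j ≤ jl₁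
    · have H := ncard_levelSetDep_top_aniso_inv_mul hρρ hvρ hΘΘ hΘρ hvΘ hα1 hα hρϖE hϖE h2 hΘh' hh' hq hσ' hvσ' hfix' hπ' hdd' hd hq' jK hjv hjΘ hjfix hjσ
        hnorm haniso hlam hu hu1 hm hjl hρt hte hme hjle hj ha hdiag (by omega)
      have hφ : (q : ℚ) ^ ((2 * a - m₁) / 2) ≠ 0 := pow_ne_zero _ hqQ0
      rw [hvMdef, hnMdef]; dsimp only; rw [if_pos hj]
      by_cases hc : jl₁ + 1 = d + m₁ ∧ 2 * j + d ≤ 2 * jl₁ + 1 + e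
      · rw [if_pos hc] at H
        rw [if_pos hc, eq_div_iff hφ]
        have := congrArg (Nat.cast : ℕ → ℚ) H
        rw [Nat.cast_mul, Nat.cast_pow] at this
        linear_combination this
      · rw [if_neg hc] at H
        rw [if_neg hc]
        rw [(mul_eq_zero.1 H).resolve_left (pow_ne_zero _ (by omega)), Nat.cast_zero]
    · rw [hvMdef]; dsimp only; rw [if_neg hj, if_neg (by omega), if_pos hdiag]
  · -- the values on `j ≤ jλ₁`
    intro j a hj
    rw [hvPdef, hvMdef]; dsimp only; rw [if_pos hj, if_pos hj]
    exact ⟨rfl, rfl⟩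

/-! ## §2 The cut weld at `μ₁`, both parity classes -/

/-- **THE TYPE-U CUT WELD AT THE SCALED MULTIPLIER — EVEN CLASS** (`jλ₁` even; `{ε = +1, m₁ ≡ d (2), 1 ≤ m₁ ≤ jλ₁ − d} ∪ {ε = −1, m₁ = jλ₁ − d + 1}`; `S − 1 ≤ m₁`; cutoff
`jλ₁ ≤ C`, `C + d ≤ m₁ + jλ₁ + 1`): `ε·Σ_{j ≤ jλ₁} Σ_a q^a·(if j + a ≤ C then #levelSetDep_h(j,a;t⁻¹(λ−u)) − #levelSetDep_{h′}(j,a;t⁻¹(λ−u)) else 0) = ★ p859859's value at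
`(m₁, jλ₁)` — `q^{m₁}·(1 + (q+1)[jλ₁∕2]_q − 2[d − d%2]_q)` minus the two cut top bands on the column window `a ∈ [a₀, a⋆]`, `a₀ = (C + m₁ − jλ₁)∕2 + 1`, `a⋆ = (2m₁ + 1 − d)∕2`.
(§1 ∘ ★ p859988 `toricCensusSum_unr_v5_cutoff_offset`.) [cite: Kottwitz1986BaseChangeUnits, §1 pp. 240–241] [cite: Rogawski1990, §4.9 Prop. 4.9.1 (b) p. 55, Lemma 4.9.3 p. 56]
[cite: Flicker1998UnitaryFL, Prop. 7 p. 84] -/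
theorem toricCensusSum_unr_weld_inv_mul [IsDiscreteValuationRing 𝒪[K]] [Finite 𝓀[K]] [IsDiscreteValuationRing 𝒪[K']] [Finite 𝓀[K']] [IsAdicComplete 𝓂[K'] 𝒪[K']]
    (hρρ : ∀ x, ρ (ρ x) = x) (hvρ : ∀ x, Valued.v (ρ x) = Valued.v x) (hΘΘ : ∀ x, Θ (Θ x) = x) (hΘρ : ∀ x, Θ (ρ x) = ρ (Θ x))
    (hvΘ : ∀ x, Valued.v (Θ x) = Valued.v x) (hα1 : Valued.v α ≤ 1) (hα : Valued.v (α - ρ α) = 1)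
    (hρϖE : ρ ϖE = ϖE) (hϖE : Valued.v ϖE = exp (-1 : ℤ)) (hq : Nat.card 𝓀[K] = q ^ 2) (h2 : Valued.v (2 : K) = Valued.v ϖE ^ t)
    (hσ' : ∀ x, σ' (σ' x) = x) (hvσ' : ∀ x, Valued.v (σ' x) = Valued.v x) (hfix' : ∀ x : K', σ' x = x → x ≠ 0 → ∃ n : ℤ, Valued.v x = exp (2 * n))
    (hπ' : Valued.v π' = exp (-1 : ℤ)) (hdd' : Valued.v (π' - σ' π') = Valued.v π' ^ d) (hd : 1 ≤ d) (hq' : Nat.card 𝓀[K'] = q)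
    (jK : K' →+* K) (hjv : ∀ x, Valued.v (jK x) = Valued.v x) (hjΘ : ∀ x, Θ (jK x) = jK x)
    (hjfix : ∀ z : K, Θ z = z → ∃ x, jK x = z) (hjσ : ∀ x, jK (σ' x) = ρ (jK x))
    (hnorm : ∀ z : Kˣ, Θ (z : K) = z → Valued.v (z : K) = 1 → ∃ ω : Kˣ, Valued.v (ω : K) = 1 ∧ (ω : K) * Θ ω = z)
    {h h' : K} (hΘh : Θ h = h) (hh : h ≠ 0) (hhyper : ∃ x : K, x ≠ 0 ∧ h * Θ x * x + ρ (h * Θ x * x) = 0)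
    (hΘh' : Θ h' = h') (hh' : h' ≠ 0) (haniso : ¬ ∃ x : K, x ≠ 0 ∧ h' * Θ x * x + ρ (h' * Θ x * x) = 0)
    {lam u : K} (hlam : lam * Θ lam = 1) (hu : ρ u = u) (hu1 : u * Θ u = 1)
    {m jl : ℕ} (hm : Valued.v (lam - u) = exp (-(m : ℤ))) (hjl : Valued.v ((lam - u) - ρ (lam - u)) = exp (-(jl : ℤ)))
    {tc : K} (hρt : ρ tc = tc) {e : ℕ} (hte : Valued.v tc = exp (-(e : ℤ))) {m₁ jl₁ : ℕ} (hme : m₁ + e = m) (hjle : jl₁ + e = jl)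
    (hq2 : 2 ≤ q) (hd2 : 2 ≤ d) (hjl2 : jl₁ % 2 = 0) (hmS : d - d % 2 ≤ m₁ + 1) (ε : ℚ)
    (hreal : (ε = 1 ∧ m₁ % 2 = d % 2 ∧ 1 ≤ m₁ ∧ m₁ + d ≤ jl₁) ∨ (ε = -1 ∧ m₁ = jl₁ - d + 1 ∧ d ≤ jl₁))
    (C : ℕ) (hC : jl₁ ≤ C) (hCe : C + d ≤ m₁ + jl₁ + 1) :
    ε * ∑ j ∈ range (jl₁ + 1), ∑ a ∈ range (jl₁ + 2), (q : ℚ) ^ a *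
        (if j + a ≤ C then ((levelSetDep ρ Θ α ϖE h j a (tc⁻¹ * (lam - u))).ncard : ℚ) - ((levelSetDep ρ Θ α ϖE h' j a (tc⁻¹ * (lam - u))).ncard : ℚ) else 0) =
      (q : ℚ) ^ m₁ * ((1 + ((q : ℚ) + 1) * ∑ i ∈ range (jl₁ / 2), (q : ℚ) ^ i) - 2 * ∑ i ∈ range (d - d % 2), (q : ℚ) ^ i)
      - (if m₁ + d ≤ jl₁ ∧ (jl₁ - m₁ - d) % 2 = 0 then
          ((q : ℚ) + 1) * (q : ℚ) ^ (((C + m₁ - jl₁) / 2 + 1) + d + (jl₁ - m₁ - d) / 2 + m₁ / 2 - 1) *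
            ∑ i ∈ range (((2 * m₁ + 1 - d) / 2 + 1) - ((C + m₁ - jl₁) / 2 + 1)), (q : ℚ) ^ i
        else 0)
      - (if jl₁ + 1 = d + m₁ then
          ((q : ℚ) + 1) * (q : ℚ) ^ (((C + m₁ - jl₁) / 2 + 1) + d + m₁ - m₁ / 2 - 2) *
            ∑ i ∈ range (((2 * m₁ + 1 - d) / 2 + 1) - ((C + m₁ - jl₁) / 2 + 1)), (q : ℚ) ^ i
        else 0) := by
  classical
  obtain ⟨nP, nM, vP, vM, hnP, hnP0, hnM, hv0, hvOff, hvLow, hvTopPE, hvTopME, hval⟩ :=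
    exists_tables_inv_mul hρρ hvρ hΘΘ hΘρ hvΘ hα1 hα hρϖE hϖE hq h2 hσ' hvσ' hfix' hπ' hdd' hd hq' jK hjv hjΘ hjfix hjσ hnorm hΘh hh hhyper hΘh' hh' haniso
      hlam hu hu1 hm hjl hρt hte hme hjle hq2
  have key := toricCensusSum_unr_v5_cutoff_offset q ε hq2 hd2 hjl2 hmS hreal nP nM vP vM hnP hnP0 hnM hv0 hvOff hvLow e hvTopPE hvTopME C hC hCe
  rw [← key]
  congr 1
  refine sum_congr rfl fun j hj => sum_congr rfl fun a _ => ?_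
  have hj' : j ≤ jl₁ := by rw [mem_range] at hj; omega
  rw [(hval j a hj').1, (hval j a hj').2]

/-- **THE TYPE-U CUT WELD AT THE SCALED MULTIPLIER — ODD CLASS** (`jλ₁` odd; `{ε = +1, m₁ ≢ d (2), 1 ≤ m₁ ≤ jλ₁ − d} ∪ {ε = −1, m₁ = jλ₁ − d + 1}` — the class of an ODD
`e = a′`; `S − 1 ≤ m₁`; cutoff `jλ₁ ≤ C`, `C + d ≤ m₁ + jλ₁ + 1`): the same cut census difference equals ★ p859898's value at `(m₁, jλ₁)` —
`q^{m₁}·(1 + (q+1)[⌊jλ₁∕2⌋ + d%2]_q − 2[d − 1 + d%2]_q)` minus the two cut top bands.  (§1 ∘ ★ p859898 `toricCensusSum_unr_v5_flip_cutoff_offset`.)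
[cite: Kottwitz1986BaseChangeUnits, §1 pp. 240–241] [cite: Rogawski1990, §4.9 Prop. 4.9.1 (b) p. 55, Lemma 4.9.3 p. 56] [cite: Flicker1998UnitaryFL, Prop. 7 p. 84] -/
theorem toricCensusSum_unr_weld_inv_mul_flip [IsDiscreteValuationRing 𝒪[K]] [Finite 𝓀[K]] [IsDiscreteValuationRing 𝒪[K']] [Finite 𝓀[K']] [IsAdicComplete 𝓂[K'] 𝒪[K']]
    (hρρ : ∀ x, ρ (ρ x) = x) (hvρ : ∀ x, Valued.v (ρ x) = Valued.v x) (hΘΘ : ∀ x, Θ (Θ x) = x) (hΘρ : ∀ x, Θ (ρ x) = ρ (Θ x))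
    (hvΘ : ∀ x, Valued.v (Θ x) = Valued.v x) (hα1 : Valued.v α ≤ 1) (hα : Valued.v (α - ρ α) = 1)
    (hρϖE : ρ ϖE = ϖE) (hϖE : Valued.v ϖE = exp (-1 : ℤ)) (hq : Nat.card 𝓀[K] = q ^ 2) (h2 : Valued.v (2 : K) = Valued.v ϖE ^ t)
    (hσ' : ∀ x, σ' (σ' x) = x) (hvσ' : ∀ x, Valued.v (σ' x) = Valued.v x) (hfix' : ∀ x : K', σ' x = x → x ≠ 0 → ∃ n : ℤ, Valued.v x = exp (2 * n))
    (hπ' : Valued.v π' = exp (-1 : ℤ)) (hdd' : Valued.v (π' - σ' π') = Valued.v π' ^ d) (hd : 1 ≤ d) (hq' : Nat.card 𝓀[K'] = q)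
    (jK : K' →+* K) (hjv : ∀ x, Valued.v (jK x) = Valued.v x) (hjΘ : ∀ x, Θ (jK x) = jK x)
    (hjfix : ∀ z : K, Θ z = z → ∃ x, jK x = z) (hjσ : ∀ x, jK (σ' x) = ρ (jK x))
    (hnorm : ∀ z : Kˣ, Θ (z : K) = z → Valued.v (z : K) = 1 → ∃ ω : Kˣ, Valued.v (ω : K) = 1 ∧ (ω : K) * Θ ω = z)
    {h h' : K} (hΘh : Θ h = h) (hh : h ≠ 0) (hhyper : ∃ x : K, x ≠ 0 ∧ h * Θ x * x + ρ (h * Θ x * x) = 0)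
    (hΘh' : Θ h' = h') (hh' : h' ≠ 0) (haniso : ¬ ∃ x : K, x ≠ 0 ∧ h' * Θ x * x + ρ (h' * Θ x * x) = 0)
    {lam u : K} (hlam : lam * Θ lam = 1) (hu : ρ u = u) (hu1 : u * Θ u = 1)
    {m jl : ℕ} (hm : Valued.v (lam - u) = exp (-(m : ℤ))) (hjl : Valued.v ((lam - u) - ρ (lam - u)) = exp (-(jl : ℤ)))
    {tc : K} (hρt : ρ tc = tc) {e : ℕ} (hte : Valued.v tc = exp (-(e : ℤ))) {m₁ jl₁ : ℕ} (hme : m₁ + e = m) (hjle : jl₁ + e = jl)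
    (hq2 : 2 ≤ q) (hd2 : 2 ≤ d) (hjl2 : jl₁ % 2 = 1) (hmS : d - d % 2 ≤ m₁ + 1) (ε : ℚ)
    (hreal : (ε = 1 ∧ m₁ % 2 ≠ d % 2 ∧ 1 ≤ m₁ ∧ m₁ + d ≤ jl₁) ∨ (ε = -1 ∧ m₁ = jl₁ - d + 1 ∧ d ≤ jl₁))
    (C : ℕ) (hC : jl₁ ≤ C) (hCe : C + d ≤ m₁ + jl₁ + 1) :
    ε * ∑ j ∈ range (jl₁ + 1), ∑ a ∈ range (jl₁ + 2), (q : ℚ) ^ a *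
        (if j + a ≤ C then ((levelSetDep ρ Θ α ϖE h j a (tc⁻¹ * (lam - u))).ncard : ℚ) - ((levelSetDep ρ Θ α ϖE h' j a (tc⁻¹ * (lam - u))).ncard : ℚ) else 0) =
      (q : ℚ) ^ m₁ * ((1 + ((q : ℚ) + 1) * ∑ i ∈ range (jl₁ / 2 + d % 2), (q : ℚ) ^ i) - 2 * ∑ i ∈ range (d - 1 + d % 2), (q : ℚ) ^ i)
      - (if m₁ + d ≤ jl₁ ∧ (jl₁ - m₁ - d) % 2 = 0 then
          ((q : ℚ) + 1) * (q : ℚ) ^ (((C + m₁ - jl₁) / 2 + 1) + d + (jl₁ - m₁ - d) / 2 + m₁ / 2 - 1) *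
            ∑ i ∈ range (((2 * m₁ + 1 - d) / 2 + 1) - ((C + m₁ - jl₁) / 2 + 1)), (q : ℚ) ^ i
        else 0)
      - (if jl₁ + 1 = d + m₁ then
          ((q : ℚ) + 1) * (q : ℚ) ^ (((C + m₁ - jl₁) / 2 + 1) + d + m₁ - m₁ / 2 - 2) *
            ∑ i ∈ range (((2 * m₁ + 1 - d) / 2 + 1) - ((C + m₁ - jl₁) / 2 + 1)), (q : ℚ) ^ i
        else 0) := by
  classical
  obtain ⟨nP, nM, vP, vM, hnP, hnP0, hnM, hv0, hvOff, hvLow, hvTopPE, hvTopME, hval⟩ :=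
    exists_tables_inv_mul hρρ hvρ hΘΘ hΘρ hvΘ hα1 hα hρϖE hϖE hq h2 hσ' hvσ' hfix' hπ' hdd' hd hq' jK hjv hjΘ hjfix hjσ hnorm hΘh hh hhyper hΘh' hh' haniso
      hlam hu hu1 hm hjl hρt hte hme hjle hq2
  have key := toricCensusSum_unr_v5_flip_cutoff_offset q ε hq2 hd2 hjl2 hmS hreal nP nM vP vM hnP hnP0 hnM hv0 hvOff hvLow e hvTopPE hvTopME C hC hCe
  rw [← key]
  congr 1
  refine sum_congr rfl fun j hj => sum_congr rfl fun a _ => ?_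
  have hj' : j ≤ jl₁ := by rw [mem_range] at hj; omega
  rw [(hval j a hj').1, (hval j a hj').2]

end Summit.HodgeConjecture.HodgeConjecture.Cruxes.H413.F0P3cDyRamToricCensusSumUnrWeldScaled
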